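import Mathlib
import HarnessLib
import Literature.Probability.MarkovChains.MetropolisHastings
import Literature.Probability.MarkovChains.TotalVariation
import Summits.Ventures.LatticeQCDFlow.Exactness.JarzynskiFinite
import Summits.Ventures.LatticeQCDFlow.Scaling.ImportanceWeights
import Summits.Ventures.LatticeQCDFlow.Scaling.StochasticFlows
import Summits.Ventures.LatticeQCDFlow.Scaling.StochasticBudgets
import Summits.Ventures.LatticeQCDFlow.Scaling.PerfectRelaxationMonotone

/-!
# LatticeQCDFlow / Scaling — perfect relaxation dominates monotone layers, FKG form ((C3‴), proved)

HONEST FRAMING: exact (Metropolis-corrected) sampling algorithms for lattice gauge theory;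
figures of merit are autocorrelation/cost numbers at stated couplings and volumes; no
continuum-physics claim.

Venture `LatticeQCDFlow` (cell pub-lqcd), topic `Scaling`, THEORY-2.md §3.5 (theory seat GEN-10).
`Scaling.PerfectRelaxationMonotone` proves (C3″) — perfect relaxation maximises the NE-MCMC / SNF
reweighting ESS among layers that are stochastically monotone for the TOTAL preorder induced by one
order parameter `A`.  The statement relevant to product / lattice state spaces (single-site heat
bath on an ATTRACTIVE system, annealed in an external field) orders configurations by a PARTIAL
order; the Chebyshev sum inequality is then replaced by the FKG inequality.  This file proves that
form on any finite distributive lattice `X`: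

* `fkg_antitone` — Mathlib's `fkg` (Fortuin–Kasteleyn–Ginibre, via the four functions theorem)
  in the dual form needed here: `(Σ μf)(Σ μg) ≤ (Σ μ)(Σ μfg)` for `μ ≥ 0` LOG-SUPERMODULAR and
  `f, g ≥ 0` both ANTITONE;
* `sqBack_antitone_lattice` — the backward second-moment function `B_k` of
  `PerfectRelaxationMonotone` is antitone for the lattice order when the increments
  `S_{k+1} − S_k` are monotone and the layers preserve antitone functions;
* `sqMoment_perfect_le_lattice` — the core comparison `Σ p₀B₀^{perfect} ≤ Σ p₀B₀^{P}` under, in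
  addition, SUBMODULARITY of every `S_{k+1}` (`e^{−S_{k+1}}` log-supermodular = the FKG lattice
  condition; automatic on a chain);
* `essFrac_path_eq_of_nonneg` — the path-space ESS formula `ÊSS = (E_F e^{−W})²/E_F e^{−2W}`
  for layers with NON-NEGATIVE entries (the tree's `essFrac_path_eq` asks for positive entries;
  Crooks' pathwise identity makes the forward and reverse path laws vanish together, so zero
  entries — single-site updates, block heat bath — are harmless);
* `perfectRelaxation_dominates_fkg` — (C3‴): `ÊSS ≤ Π_k ESS(p_{k+1}, p_k)` for non-negative,
  `e^{−S_{k+1}}`-stationary, monotone layers along a protocol with monotone increments and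
  submodular `S_1, …, S_n`;
* `perfectRelaxation_dominates_monotone'`, `perfectRelaxation_dominates_expFamily'` — the
  total-preorder forms (C3″) of `PerfectRelaxationMonotone` with positivity of the entries weakened
  to non-negativity (so `_expFamily'` has exactly the binders of the refuted (C3′) with
  positive-semidefiniteness replaced by monotonicity, nothing added).

By linearity a layer preserves antitone functions iff it preserves monotone ones, and the whole
statement is self-dual (apply it on `Xᵒᵈ` for antitone increments).  References: Fortuin–Kasteleyn–
Ginibre (1971); Holley (1974); arXiv:2510.25704 §3.1 (perfect-relaxation law).  [folklore]
-/

noncomputable section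

namespace Summit.Ventures.LatticeQCDFlow.Theory2

open Finset Literature.Probability.MarkovChains Summit.Ventures.LatticeQCDFlow.Exactness

variable {X : Type*} [DistribLattice X] [Fintype X]

/-- **FKG inequality, antitone form**: on a finite distributive lattice, for a non-negative
log-supermodular weight `μ` and non-negative antitone `f, g`,
`(Σ μ f)(Σ μ g) ≤ (Σ μ)(Σ μ f g)` (Mathlib's `fkg` on the order dual). [folklore] -/
theorem fkg_antitone (μ f g : X → ℝ) (hμ0 : ∀ x, 0 ≤ μ x) (hf0 : ∀ x, 0 ≤ f x)
    (hg0 : ∀ x, 0 ≤ g x) (hf : Antitone f) (hg : Antitone g)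
    (hμ : ∀ a b, μ a * μ b ≤ μ (a ⊓ b) * μ (a ⊔ b)) :
    (∑ x, μ x * f x) * (∑ x, μ x * g x) ≤ (∑ x, μ x) * ∑ x, μ x * (f x * g x) := by
  have h := fkg (α := Xᵒᵈ) (fun a => f (OrderDual.ofDual a)) (fun a => g (OrderDual.ofDual a))
    (fun a => μ (OrderDual.ofDual a)) (fun a => hμ0 _) (fun a => hf0 _) (fun a => hg0 _)
    hf.dual_left hg.dual_left (fun a b => by
      change μ (OrderDual.ofDual a) * μ (OrderDual.ofDual b) ≤
        μ (OrderDual.ofDual a ⊔ OrderDual.ofDual b) * μ (OrderDual.ofDual a ⊓ OrderDual.ofDual b)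
      rw [mul_comm (μ (_ ⊔ _))]
      exact hμ _ _)
  exact h

/-- `B` is antitone for the lattice order when the increments are monotone and the layers are
non-negative and preserve antitone functions. [folklore] -/
theorem sqBack_antitone_lattice : ∀ (n : ℕ) (S : Fin (n + 1) → X → ℝ)
    (P : Fin n → X → X → ℝ),
    (∀ k : Fin n, Monotone fun x => S k.succ x - S k.castSucc x) →
    (∀ k x y, 0 ≤ P k x y) →
    (∀ (k : Fin n) (f : X → ℝ), Antitone f → Antitone fun x => ∑ z, P k x z * f z) →
    Antitone (sqBack n S P)
  | 0, S, P, _, _, _ => fun x y _ => by simp [sqBack]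
  | n + 1, S, P, hinc, hP, hmono => by
      intro x y hxy
      rw [sqBack, sqBack]
      have ih := sqBack_antitone_lattice n (fun k => S k.succ) (fun k => P k.succ)
        (fun k => hinc k.succ) (fun k => hP k.succ) (fun k => hmono k.succ)
      have h1 : Real.exp (-(S 1 y - S 0 y)) ^ 2 ≤ Real.exp (-(S 1 x - S 0 x)) ^ 2 := by
        refine pow_le_pow_left₀ (Real.exp_pos _).le (Real.exp_le_exp.mpr ?_) 2
        have := hinc 0 hxy
        simp only [Fin.succ_zero_eq_one, Fin.castSucc_zero] at this
        linarith
      exact mul_le_mul h1 (hmono 0 _ ih hxy) (sum_nonneg fun z _ => mul_nonneg (hP 0 y z)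
        (sqBack_nonneg n _ _ (fun k => hP k.succ) z)) (pow_nonneg (Real.exp_pos _).le _)

/-- **Core comparison, FKG form**: `Σ p₀ B₀^{perfect} ≤ Σ p₀ B₀^{P}` for non-negative,
`e^{−S_{k+1}}`-stationary layers preserving antitone functions, monotone increments and
SUBMODULAR `S_1, …, S_n`. [folklore] -/
theorem sqMoment_perfect_le_lattice [Nonempty X] : ∀ (n : ℕ) (S : Fin (n + 1) → X → ℝ)
    (P : Fin n → X → X → ℝ),
    (∀ k : Fin n, Monotone fun x => S k.succ x - S k.castSucc x) →
    (∀ (k : Fin n) (a b : X), S k.succ (a ⊓ b) + S k.succ (a ⊔ b) ≤ S k.succ a + S k.succ b) →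
    (∀ k x y, 0 ≤ P k x y) →
    (∀ k : Fin n, IsStationary (fun x => Real.exp (-(S k.succ x))) (P k)) →
    (∀ (k : Fin n) (f : X → ℝ), Antitone f → Antitone fun x => ∑ z, P k x z * f z) →
    ∑ x, gibbsLaw (S 0) x * sqBack n S (fun k _ y => gibbsLaw (S k.succ) y) x ≤
      ∑ x, gibbsLaw (S 0) x * sqBack n S P x
  | 0, S, P, _, _, _, _, _ => by simp [sqBack]
  | n + 1, S, P, hinc, hsub, hP, hst, hmono => by
      set S' : Fin (n + 1) → X → ℝ := fun k => S k.succ with hS'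
      set B : X → ℝ := sqBack n S' (fun k => P k.succ) with hB
      set Bp : X → ℝ := sqBack n S' (fun k _ y => gibbsLaw (S' k.succ) y) with hBp
      set m : X → ℝ := fun x => Real.exp (-(S 1 x)) with hm
      set u : X → ℝ := fun x => Real.exp (-(S 1 x - S 0 x)) with hu
      set g : X → ℝ := fun x => ∑ z, P 0 x z * B z with hg
      have hm0 : ∀ x, 0 ≤ m x := fun x => (Real.exp_pos _).le
      have hZ1 : 0 < partitionFn (S 1) := partitionFn_pos (S 1)
      have hZ0 : 0 < partitionFn (S 0) := partitionFn_pos (S 0)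
      have hZ1eq : ∑ x, m x = partitionFn (S 1) := rfl
      have ih : ∑ z, gibbsLaw (S 1) z * Bp z ≤ ∑ z, gibbsLaw (S 1) z * B z :=
        sqMoment_perfect_le_lattice n S' (fun k => P k.succ) (fun k => hinc k.succ)
          (fun k => hsub k.succ) (fun k => hP k.succ) (fun k => hst k.succ) (fun k => hmono k.succ)
      have hB0 : ∀ z, 0 ≤ B z := sqBack_nonneg n S' (fun k => P k.succ) (fun k => hP k.succ)
      have hu_anti : Antitone u := fun x y hxy => by
        have := hinc 0 hxy
        simp only [Fin.succ_zero_eq_one, Fin.castSucc_zero] at this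
        exact Real.exp_le_exp.mpr (by linarith)
      have hB_anti : Antitone B :=
        sqBack_antitone_lattice n S' (fun k => P k.succ) (fun k => hinc k.succ)
          (fun k => hP k.succ) (fun k => hmono k.succ)
      have hg_anti : Antitone g := hmono 0 B hB_anti
      have hlsm : ∀ a b, m a * m b ≤ m (a ⊓ b) * m (a ⊔ b) := fun a b => by
        have := hsub 0 a b
        simp only [Fin.succ_zero_eq_one] at this
        simp only [hm, ← Real.exp_add]
        exact Real.exp_le_exp.mpr (by linarith)
      -- FKG under the log-supermodular weight `m = e^{−S₁}`
      have hcheb := fkg_antitone m u g hm0 (fun x => (Real.exp_pos _).le)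
        (fun x => sum_nonneg fun z _ => mul_nonneg (hP 0 x z) (hB0 z)) hu_anti hg_anti hlsm
      have hst0 : ∀ z, ∑ x, m x * P 0 x z = m z := by
        have := hst 0
        simp only [Literature.Probability.MarkovChains.IsStationary, Fin.succ_zero_eq_one] at this
        exact this
      have hmg : ∑ x, m x * g x = partitionFn (S 1) * ∑ z, gibbsLaw (S 1) z * B z := by
        calc ∑ x, m x * g x = ∑ z, (∑ x, m x * P 0 x z) * B z := by
              simp only [hg, mul_sum, sum_mul]
              rw [sum_comm]
              refine sum_congr rfl fun z _ => sum_congr rfl fun x _ => ?_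
              ring
          _ = ∑ z, m z * B z := sum_congr rfl fun z _ => by rw [hst0 z]
          _ = partitionFn (S 1) * ∑ z, gibbsLaw (S 1) z * B z := by
              rw [mul_sum]
              refine sum_congr rfl fun z _ => ?_
              rw [gibbsLaw, ← mul_assoc, mul_div_cancel₀ _ hZ1.ne']
      have hL : ∑ x, gibbsLaw (S 0) x * sqBack (n + 1) S (fun k _ y => gibbsLaw (S k.succ) y) x =
          (partitionFn (S 0))⁻¹ * ((∑ x, m x * u x) * ∑ z, gibbsLaw (S 1) z * Bp z) := by
        simp only [gibbsLaw_mul_sqBack_succ, ← mul_sum]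
        congr 1
        rw [sum_mul]
        refine sum_congr rfl fun x _ => ?_
        simp only [hm, hu, hBp, hS', Fin.succ_zero_eq_one]
        ring
      have hR : ∑ x, gibbsLaw (S 0) x * sqBack (n + 1) S P x =
          (partitionFn (S 0))⁻¹ * ∑ x, m x * (u x * g x) := by
        simp only [gibbsLaw_mul_sqBack_succ, ← mul_sum]
        rfl
      rw [hL, hR]
      refine mul_le_mul_of_nonneg_left ?_ (inv_nonneg.mpr hZ0.le)
      have hmu0 : 0 ≤ ∑ x, m x * u x :=
        sum_nonneg fun x _ => mul_nonneg (hm0 x) (Real.exp_pos _).le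
      have step1 : (∑ x, m x * u x) * ∑ z, gibbsLaw (S 1) z * Bp z ≤
          (∑ x, m x * u x) * ∑ z, gibbsLaw (S 1) z * B z := mul_le_mul_of_nonneg_left ih hmu0
      have step2 : partitionFn (S 1) * ((∑ x, m x * u x) * ∑ z, gibbsLaw (S 1) z * B z) ≤
          partitionFn (S 1) * ∑ x, m x * (u x * g x) := by
        calc partitionFn (S 1) * ((∑ x, m x * u x) * ∑ z, gibbsLaw (S 1) z * B z)
            = (∑ x, m x * u x) * (∑ x, m x * g x) := by rw [hmg]; ring
          _ ≤ (∑ x, m x) * ∑ x, m x * (u x * g x) := hcheb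
          _ = partitionFn (S 1) * ∑ x, m x * (u x * g x) := by rw [hZ1eq]
      exact step1.trans (le_of_mul_le_mul_left step2 hZ1)

omit [DistribLattice X] in
/-- **Path-space ESS formula for NON-NEGATIVE layers**: by Crooks' pathwise identity the reverse
path law is `(Z_0/Z_n)·P_F·e^{−W}`, so `ÊSS = essFrac (revPathLaw S P) (pathLaw p₀ P) =
(E_F e^{−W})² / E_F e^{−2W}` with no positivity assumption on the entries (paths of forward
probability zero carry reverse probability zero and drop out of both sides). [folklore] -/
theorem essFrac_path_eq_of_nonneg [Nonempty X] {n : ℕ} (S : Fin (n + 1) → X → ℝ)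
    (P : Fin n → X → X → ℝ) :
    essFrac (revPathLaw S P) (pathLaw (gibbsLaw (S 0)) P) =
      (∑ ω, pathLaw (gibbsLaw (S 0)) P ω * Real.exp (-(work S ω))) ^ 2 /
        ∑ ω, pathLaw (gibbsLaw (S 0)) P ω * Real.exp (-(work S ω)) ^ 2 := by
  set c : ℝ := partitionFn (S (Fin.last n)) / partitionFn (S 0) with hc
  have hcpos : 0 < c := div_pos (partitionFn_pos _) (partitionFn_pos _)
  have hrev : ∀ ω, revPathLaw S P ω =
      c⁻¹ * (pathLaw (gibbsLaw (S 0)) P ω * Real.exp (-(work S ω))) := fun ω => by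
    rw [crooks_pathwise S P ω, ← mul_assoc, inv_mul_cancel₀ hcpos.ne', one_mul]
  have h1 : ∀ ω, pathLaw (gibbsLaw (S 0)) P ω *
      weight (revPathLaw S P) (pathLaw (gibbsLaw (S 0)) P) ω =
        c⁻¹ * (pathLaw (gibbsLaw (S 0)) P ω * Real.exp (-(work S ω))) := fun ω => by
    unfold weight
    by_cases hω : pathLaw (gibbsLaw (S 0)) P ω = 0
    · simp [hω]
    · rw [mul_comm, div_mul_cancel₀ _ hω, hrev]
  have h2 : ∀ ω, pathLaw (gibbsLaw (S 0)) P ω *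
      weight (revPathLaw S P) (pathLaw (gibbsLaw (S 0)) P) ω ^ 2 =
        c⁻¹ ^ 2 * (pathLaw (gibbsLaw (S 0)) P ω * Real.exp (-(work S ω)) ^ 2) := fun ω => by
    unfold weight
    by_cases hω : pathLaw (gibbsLaw (S 0)) P ω = 0
    · simp [hω]
    · rw [hrev]
      field_simp
  unfold essFrac
  simp_rw [h1, h2]
  rw [← mul_sum, ← mul_sum, mul_pow,
    mul_div_mul_left _ _ (pow_ne_zero 2 (inv_ne_zero hcpos.ne'))]

/-- **(C3‴) PERFECT RELAXATION DOMINATES MONOTONE LAYERS — FKG / partial-order form (proved).**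
On a finite distributive lattice of configurations: protocol `S_0, …, S_n` with MONOTONE
increments `S_{k+1} − S_k` and SUBMODULAR `S_1, …, S_n` (the FKG lattice condition for
`e^{−S_k}`), layers with positive entries leaving `e^{−S_{k+1}}` stationary and preserving
antitone (equivalently, monotone) functions — entries only NON-NEGATIVE (single-site / block
updates allowed) ⟹ `ÊSS ≤ Π_k ESS(p_{k+1}, p_k)`. [folklore] -/
theorem perfectRelaxation_dominates_fkg [Nonempty X] [DecidableEq X] {n : ℕ}
    (S : Fin (n + 1) → X → ℝ) (P : Fin n → X → X → ℝ)
    (hinc : ∀ k : Fin n, Monotone fun x => S k.succ x - S k.castSucc x)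
    (hsub : ∀ (k : Fin n) (a b : X), S k.succ (a ⊓ b) + S k.succ (a ⊔ b) ≤ S k.succ a + S k.succ b)
    (hP0 : ∀ k x y, 0 ≤ P k x y)
    (hst : ∀ k : Fin n, IsStationary (fun x => Real.exp (-(S k.succ x))) (P k))
    (hmono : ∀ (k : Fin n) (f : X → ℝ), Antitone f → Antitone fun x => ∑ z, P k x z * f z) :
    essFrac (revPathLaw S P) (pathLaw (gibbsLaw (S 0)) P) ≤
      ∏ k : Fin n, essFrac (gibbsLaw (S k.succ)) (gibbsLaw (S k.castSucc)) := by
  have hPerf : ∀ (k : Fin n) (x y : X), 0 < (fun (k : Fin n) (_ : X) (y : X) =>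
      gibbsLaw (S k.succ) y) k x y := fun k _ y => gibbsLaw_pos (S k.succ) y
  have hM : ∑ ω : Fin (n + 1) → X, pathLaw (gibbsLaw (S 0)) (fun k _ y => gibbsLaw (S k.succ) y) ω *
        Real.exp (-(work S ω)) ^ 2 ≤
      ∑ ω : Fin (n + 1) → X, pathLaw (gibbsLaw (S 0)) P ω * Real.exp (-(work S ω)) ^ 2 := by
    rw [sum_pathLaw_mul_exp_sq, sum_pathLaw_mul_exp_sq]
    exact sqMoment_perfect_le_lattice n S P hinc hsub hP0 hst hmono
  have hpos : 0 < ∑ ω : Fin (n + 1) → X, pathLaw (gibbsLaw (S 0))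
      (fun k _ y => gibbsLaw (S k.succ) y) ω * Real.exp (-(work S ω)) ^ 2 :=
    sum_pos (fun ω _ => mul_pos (pathLaw_pos (gibbsLaw_pos (S 0)) hPerf ω)
      (pow_pos (Real.exp_pos _) 2)) univ_nonempty
  rw [← ess_perfect_relaxation S, essFrac_path_eq_of_nonneg S P, essFrac_path_eq_of_nonneg S,
    jarzynski S P hst, jarzynski S _ (isStationary_perfect S)]
  exact div_le_div_of_nonneg_left (sq_nonneg _) hpos hM

/-! ## (C3″) with non-negative entries -/

section TotalPreorder

omit [DistribLattice X]

/-- **(C3″), non-negative entries**: `perfectRelaxation_dominates_monotone` of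
`PerfectRelaxationMonotone` with `0 < P k x y` weakened to `0 ≤ P k x y`. [folklore] -/
theorem perfectRelaxation_dominates_monotone' [Nonempty X] [DecidableEq X] {n : ℕ} (A : X → ℝ)
    (S : Fin (n + 1) → X → ℝ) (P : Fin n → X → X → ℝ)
    (hinc : ∀ (k : Fin n) (x y : X), A x ≤ A y →
      S k.succ x - S k.castSucc x ≤ S k.succ y - S k.castSucc y)
    (hP0 : ∀ k x y, 0 ≤ P k x y)
    (hst : ∀ k : Fin n, IsStationary (fun x => Real.exp (-(S k.succ x))) (P k))
    (hmono : ∀ (k : Fin n) (f : X → ℝ), (∀ x y, A x ≤ A y → f y ≤ f x) →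
      ∀ x y, A x ≤ A y → ∑ z, P k y z * f z ≤ ∑ z, P k x z * f z) :
    essFrac (revPathLaw S P) (pathLaw (gibbsLaw (S 0)) P) ≤
      ∏ k : Fin n, essFrac (gibbsLaw (S k.succ)) (gibbsLaw (S k.castSucc)) := by
  have hPerf : ∀ (k : Fin n) (x y : X), 0 < (fun (k : Fin n) (_ : X) (y : X) =>
      gibbsLaw (S k.succ) y) k x y := fun k _ y => gibbsLaw_pos (S k.succ) y
  have hM : ∑ ω : Fin (n + 1) → X, pathLaw (gibbsLaw (S 0)) (fun k _ y => gibbsLaw (S k.succ) y) ω *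
        Real.exp (-(work S ω)) ^ 2 ≤
      ∑ ω : Fin (n + 1) → X, pathLaw (gibbsLaw (S 0)) P ω * Real.exp (-(work S ω)) ^ 2 := by
    rw [sum_pathLaw_mul_exp_sq, sum_pathLaw_mul_exp_sq]
    exact sqMoment_perfect_le A n S P hinc hP0 hst hmono
  have hpos : 0 < ∑ ω : Fin (n + 1) → X, pathLaw (gibbsLaw (S 0))
      (fun k _ y => gibbsLaw (S k.succ) y) ω * Real.exp (-(work S ω)) ^ 2 :=
    sum_pos (fun ω _ => mul_pos (pathLaw_pos (gibbsLaw_pos (S 0)) hPerf ω)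
      (pow_pos (Real.exp_pos _) 2)) univ_nonempty
  rw [← ess_perfect_relaxation S, essFrac_path_eq_of_nonneg S P, essFrac_path_eq_of_nonneg S,
    jarzynski S P hst, jarzynski S _ (isStationary_perfect S)]
  exact div_le_div_of_nonneg_left (sq_nonneg _) hpos hM

/-- **(C3″), exponential-family form, with EXACTLY the binders of the refuted (C3′)** except
that positive-semidefiniteness is replaced by stochastic monotonicity in `A` (row-stochasticity
supplies the non-negativity of the entries). [folklore] -/
theorem perfectRelaxation_dominates_expFamily' (Y : Type) [Fintype Y] [DecidableEq Y]
    [Nonempty Y] (n : ℕ) (A : Y → ℝ) (β : Fin (n + 1) → ℝ) (P : Fin n → Y → Y → ℝ)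
    (hβ : Monotone β) (hrow : ∀ k, IsRowStochastic (P k))
    (hdb : ∀ k : Fin n, DetailedBalance (fun x => Real.exp (-(β k.succ * A x))) (P k))
    (hmono : ∀ (k : Fin n) (f : Y → ℝ), (∀ x y, A x ≤ A y → f y ≤ f x) →
      ∀ x y, A x ≤ A y → ∑ z, P k y z * f z ≤ ∑ z, P k x z * f z) :
    essFrac (revPathLaw (fun k x => β k * A x) P)
        (pathLaw (gibbsLaw (fun x => β 0 * A x)) P) ≤
      ∏ k : Fin n, essFrac (gibbsLaw (fun x => β k.succ * A x))
        (gibbsLaw (fun x => β k.castSucc * A x)) :=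
  perfectRelaxation_dominates_monotone' A (fun k x => β k * A x) P
    (fun k x y hxy => by
      have hk : β k.castSucc ≤ β k.succ := hβ Fin.castSucc_lt_succ.le
      nlinarith)
    (fun k => (hrow k).1) (fun k => (hdb k).isStationary (hrow k).2) hmono

end TotalPreorder

end Summit.Ventures.LatticeQCDFlow.Theory2

end
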